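import Mathlib
import Summits.ResolutionOfSingularities.ResolutionOfSingularities.Theorems.WeightedInvariantLocalWeightedDropWildMonicFlagNnDefs

/-!
# `WeightedInvariant.LocalWeightedDrop`, line `hasse-ridge-face-selection`, S3ρ sub-stub S3ρD `stub_wildMonicSurfaceDescent`:
# the LEXICOGRAPHIC DROP of the flag pair `(d_𝓕, n_𝓕)` in Perlega's cases (2) and (3) of Prop. 9.1.4, on point sets

Crux item stmt-ResolutionOfSingularities-8899 `LocalWeightedDrop` (route `ResolutionOfSingularities/WeightedInvariant`), engine of the
door `HypersurfaceCentreConstruction` stmt-ResolutionOfSingularities-19897.  [OURS · L1 W4.3, chain w43, res-L1-w43-stub-5 = seat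
res-D-pv-056, third seat on S3ρ; glue for the assembly (C9) and for D-0 (res-L1-w43-stub-3) over `…WildMonicFlagN1Transport` (p502818),
`…WildMonicFlagNnTransport` (p504642) and `…WildMonicFlagNnDefs` (p506745).  MODEL: Perlega, arXiv:2011.14443, Ch. 9 Prop. 9.1.4 cases
(2) «n_𝓖 = 0, t ≠ 0, E = V(xy)» and (3) «n_𝓖 ≥ 1, D_𝓖 ≠ D_new»; nothing here is a statement of H. Hironaka's manuscript; OUR lemmas.]

The measure of S3ρD compares flag values LEXICOGRAPHICALLY: `(d, n, s)`.  This file spells the two comparisons that need no cleanness: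
* `lexPair_lt_case2` — CASE (2) (kangaroo direction, both boundary components lost): the coordinate flag of the successor (tangency `0`,
  residual order `dRes {0} (psi L '' N)`) against the `n = 1` flag of the sheared source (value `(dFlagN L 1 N, 1)`): whenever the source
  flag is NON-DEGENERATE (`dFlagN L 1 N = initHeight 1 N`, i.e. not in Perlega's `d_𝓕 = −1` convention — the degenerate case is Lemma
  9.1.3, `…FlagN1Transport.termSR_shape_of_lost_image_psi` / `…FlagN1TermMono`), the pair drops: `d′ < d ∨ (d′ = d ∧ 0 < 1)`;
* `lexPair_lt_case3` — CASE (3) (the new point stays on a tangent flag's curve): `(dFlagN L n (psi L '' N), n) <lex (dFlagN L (n+1) N, n+1)`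
  with EQUAL first components (`dFlagN_image_psi`);
* `lexTriple_lt_of_pair_lt` — a pair drop is a triple drop for any third components (the `s`-entries, `0` for tangent flags).
AI-written; gate-accepted means sorry-free with standard axioms, not refereed.
-/

set_option linter.dupNamespace false -- mandated namespace of this single-conjunct summit

namespace Summit.ResolutionOfSingularities.ResolutionOfSingularities.Theorems

namespace WildMonic

open MonicDescent

variable {N : Set (Fin 2 →₀ ℕ)} {L : ℕ}

/-- CASE (2) OF PROP. 9.1.4 (pair form).  After a kangaroo-direction point step the successor's coordinate flag (`n = 0`, residual order
`dRes {0} (psi L '' N)`) lies lexicographically below the source's `n = 1` flag `(dFlagN L 1 N, 1)` as soon as that flag is non-degenerate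
(`dFlagN L 1 N = initHeight 1 N`). -/
theorem lexPair_lt_case2 (hN : N.Nonempty) (hL : ∀ P ∈ N, L ≤ P 0 + P 1) (hnd : dFlagN L 1 N = initHeight 1 N) :
    dRes {0} (psi L '' N) < dFlagN L 1 N ∨ (dRes {0} (psi L '' N) = dFlagN L 1 N ∧ (0 : ℕ) < 1) := by
  have h : dRes {0} (psi L '' N) ≤ dFlagN L 1 N := by
    rw [hnd, initHeight_one_eq_gammaL]
    exact dRes_lost_image_psi_le_gammaL hN hL
  rcases h.lt_or_eq with hlt | heq
  · exact Or.inl hlt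
  · exact Or.inr ⟨heq, Nat.one_pos⟩

/-- CASE (2), `Prod.Lex` form on `ℕ × ℕ`. -/
theorem prodLex_lt_case2 (hN : N.Nonempty) (hL : ∀ P ∈ N, L ≤ P 0 + P 1) (hnd : dFlagN L 1 N = initHeight 1 N) :
    Prod.Lex (· < ·) (· < ·) (dRes {0} (psi L '' N), 0) (dFlagN L 1 N, 1) := by
  rcases lexPair_lt_case2 hN hL hnd with hlt | ⟨heq, h01⟩
  · exact Prod.Lex.left _ _ hlt
  · rw [heq]; exact Prod.Lex.right _ h01

/-- CASE (3) OF PROP. 9.1.4 (pair form).  When the new point stays on the curve of a tangent flag of tangency `n + 1`, the induced flag has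
tangency `n` and THE SAME `d`, so the pair drops in the second component. -/
theorem lexPair_lt_case3 (n : ℕ) (hN : N.Nonempty) (hL : ∀ P ∈ N, L ≤ P 0 + P 1) :
    dFlagN L n (psi L '' N) = dFlagN L (n + 1) N ∧ n < n + 1 :=
  ⟨dFlagN_image_psi n hN hL, Nat.lt_succ_self n⟩

/-- CASE (3), `Prod.Lex` form on `ℕ × ℕ`. -/
theorem prodLex_lt_case3 (n : ℕ) (hN : N.Nonempty) (hL : ∀ P ∈ N, L ≤ P 0 + P 1) :
    Prod.Lex (· < ·) (· < ·) (dFlagN L n (psi L '' N), n) (dFlagN L (n + 1) N, n + 1) := by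
  rw [(lexPair_lt_case3 n hN hL).1]
  exact Prod.Lex.right _ (Nat.lt_succ_self n)

/-- A drop of the pair `(d, n)` is a drop of the triple `(d, n, s)` whatever the third components are. -/
theorem lexTriple_lt_of_pair_lt {α : Type*} [LT α] {d d' n n' : ℕ} (s s' : α)
    (h : Prod.Lex (· < ·) (· < ·) (d', n') (d, n)) :
    Prod.Lex (· < ·) (Prod.Lex (· < ·) (· < ·)) (d', (n', s')) (d, (n, s)) := by
  rcases h with ⟨_, _, hlt⟩ | ⟨_, hlt⟩
  · exact Prod.Lex.left _ _ hlt
  · exact Prod.Lex.right _ (Prod.Lex.left _ _ hlt)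

end WildMonic

end Summit.ResolutionOfSingularities.ResolutionOfSingularities.Theorems
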